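import Summits.SmoothPoincare4.SmoothPoincare4.Theses.WeylBudget
import Literature.Topology.FourManifolds.GluingConstruction
import Literature.Topology.FourManifolds.GluedMetric
import Literature.Geometry.Manifold.SmoothEmbeddingCodRestrict
import Literature.Geometry.Lorentzian.LorentzianMetric
import Literature.Geometry.Lorentzian.LorentzianMetricProofs
import Literature.Geometry.Manifold.OpenSubmanifoldMFDeriv
import HarnessLib

/-!
# Stub `stub_isometricRegluing` of the line `birth` for the crux `CorkRegluablePsc`

Isometric regluing of a Riemannian metric on `S⁴ = C ∪_φ W` along a germ isometry `T` of a
neighbourhood `U` of the seam `jC(∂C)`: cut the sphere along the seam and reglue the open pieces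
`A = U ∪ (S⁴ ∖ jW(W))`, `B = U ∪ (S⁴ ∖ jC(C))` by `T|U` (`Literature.Topology.FourManifolds.SmoothGlueData`);
the restricted metrics descend (`SmoothGlueData.exists_metric_of_glue_isometry`) since `T^* g = g`,
and `inl ∘ jC`, `inr ∘ jW` exhibit the glued manifold as `C ∪_(φ ∘ τ) W`. References: Hirsch,
*Differential Topology* (1976), Ch. 8 §2; Kosinski, *Differential Manifolds* (1993), VI.1;
O'Neill, *Semi-Riemannian Geometry* (1983), Ch. 3, pp. 58, 90–91; Lee (2013), Prop. 3.9.
-/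

noncomputable section

-- `Summit.<Summit>.<Problem>`: for the single-conjunct summit the duplicate component is mandated.
set_option linter.dupNamespace false

open scoped Manifold ContDiff Topology
open Set Function Filter TopologicalSpace

namespace Summit.SmoothPoincare4.SmoothPoincare4.Theorems

open Literature.Topology.FourManifolds Literature.Geometry.Lorentzian
  Literature.Geometry.Manifold

/-- Transport of a fibrewise bilinear form along an equality of base points (the fibres
`TangentSpace I x = E` do not depend on the point). [folklore] -/
theorem bilin_congr_point
    {E H : Type*} [NormedAddCommGroup E] [NormedSpace ℝ E] [TopologicalSpace H]
    {I : ModelWithCorners ℝ E H} {M : Type*} [TopologicalSpace M] [ChartedSpace H M]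
    (b : ∀ x : M, TangentSpace I x →L[ℝ] TangentSpace I x →L[ℝ] ℝ) {x y : M} (h : x = y)
    (v w : E) : b x v w = b y v w := by
  subst h; rfl

/-- A map `g : X → U'` into an open submanifold which agrees near `x` with `f : X → M'` (after
the inclusion `U' ⊆ M'`) has at `x` every manifold derivative that `f` has (the chart of `U'` at
`g x` is the restricted chart of `M'` at `f x`; Lee, *Introduction to Smooth Manifolds* (2013),
Example 1.26 and Prop. 3.9: `T_p U = T_p M`). [folklore] -/
theorem hasMFDerivAt_opens_congr
    {E H : Type*} [NormedAddCommGroup E] [NormedSpace ℝ E] [TopologicalSpace H]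
    {I : ModelWithCorners ℝ E H} {E' H' : Type*} [NormedAddCommGroup E'] [NormedSpace ℝ E']
    [TopologicalSpace H'] {I' : ModelWithCorners ℝ E' H'}
    {X : Type*} [TopologicalSpace X] [ChartedSpace H X]
    {M' : Type*} [TopologicalSpace M'] [ChartedSpace H' M'] {U' : Opens M'}
    {f : X → M'} {g : X → U'} {x : X} (hfg : ∀ᶠ y in 𝓝 x, (g y : M') = f y)
    {f' : E →L[ℝ] E'} (hf : HasMFDerivAt I I' f x f') : HasMFDerivAt I I' g x f' := by
  have hgx : (g x : M') = f x := hfg.self_of_nhds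
  refine ⟨?_, ?_⟩
  · rw [Topology.IsInducing.subtypeVal.continuousAt_iff]
    exact hf.1.congr_of_eventuallyEq hfg
  · have h4 : ContinuousAt (extChartAt I x).symm ((extChartAt I x) x) :=
      continuousAt_extChartAt_symm x
    rw [ContinuousAt, extChartAt_to_inv x] at h4
    have heq : writtenInExtChartAt I I' x g =ᶠ[𝓝 ((extChartAt I x) x)]
        writtenInExtChartAt I I' x f := by
      filter_upwards [h4.eventually hfg] with z hz
      simp only [writtenInExtChartAt, Function.comp_apply, extChartAt_coe,
        TopologicalSpace.Opens.chartAt_eq, OpenPartialHomeomorph.subtypeRestr_coe,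
        restrict_apply, hgx, hz]
    exact hf.2.congr_of_eventuallyEq (heq.filter_mono nhdsWithin_le_nhds) heq.eq_of_nhds

/-- The map `a ↦ T a` on `U ⊆ A`, corestricted to an open submanifold `B ⊇ U` (and extended by a
constant off `U`): it acts as `T`, maps `U` to `U`, and is continuous and `C^∞` on `U` (smoothness
into an open submanifold is tested after the inclusion, Mathlib's
`ContMDiffWithinAt.subtypeVal_comp_iff`). [folklore] -/
theorem exists_glueMap
    {E H : Type*} [NormedAddCommGroup E] [NormedSpace ℝ E] [TopologicalSpace H]
    {I : ModelWithCorners ℝ E H} {M : Type*} [TopologicalSpace M] [ChartedSpace H M]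
    {U : Set M} {T : M → M} (hT : ContMDiffOn I I ∞ T U) (hTU : ∀ x ∈ U, T x ∈ U)
    (A B : Opens M) (hUB : U ⊆ B) (b₀ : B) :
    ∃ f : A → B, (∀ a : A, (a : M) ∈ U → (f a : M) = T a) ∧
      (∀ a : A, (a : M) ∈ U → (f a : M) ∈ U) ∧ ContinuousOn f {a : A | (a : M) ∈ U} ∧
      ContMDiffOn I I ∞ f {a : A | (a : M) ∈ U} := by
  classical
  let f : A → B := fun a => if h : (a : M) ∈ U then ⟨T a, hUB (hTU _ h)⟩ else b₀
  have hf : ∀ a : A, (a : M) ∈ U → (f a : M) = T a := fun a h => by simp only [f, dif_pos h]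
  have hs : ContMDiffOn I I ∞ (T ∘ (Subtype.val : A → M)) {a : A | (a : M) ∈ U} :=
    hT.comp contMDiff_subtype_val.contMDiffOn fun y hy => hy
  refine ⟨f, hf, fun a h => by rw [hf a h]; exact hTU _ h, ?_, fun a ha => ?_⟩
  · rw [Topology.IsInducing.subtypeVal.continuousOn_iff]
    exact hs.continuousOn.congr fun a ha => hf a ha
  · apply (ContMDiffWithinAt.subtypeVal_comp_iff B _ _ _).1
    exact (hs a ha).congr (fun y hy => hf y hy) (hf a ha)

/-- **Regluing datum.** Let `T` be `C^∞` on an open set `U` of a manifold `M` with `T(U) ⊆ U`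
and `T ∘ T = id` on `U`, and let `A`, `B` be open submanifolds containing `U` (and a point
each). Then `T|U : A ⇀ B` is a gluing datum (`SmoothGlueData`): an open partial homeomorphism
with source `U ⊆ A`, target `U ⊆ B`, smooth in both directions, acting as `T` (Kosinski,
*Differential Manifolds* (1993), VI.1). [folklore] -/
theorem exists_smoothGlueData_of_involutive
    {E H : Type*} [NormedAddCommGroup E] [NormedSpace ℝ E] [TopologicalSpace H]
    {I : ModelWithCorners ℝ E H} {M : Type*} [TopologicalSpace M] [ChartedSpace H M]
    {U : Set M} {T : M → M} (hU : IsOpen U) (hT : ContMDiffOn I I ∞ T U)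
    (hTU : ∀ x ∈ U, T x ∈ U) (hTT : ∀ x ∈ U, T (T x) = x)
    (A B : Opens M) (hUA : U ⊆ A) (hUB : U ⊆ B) (a₀ : A) (b₀ : B) :
    ∃ d : SmoothGlueData I I A B E,
      d.glue.source = {a : A | (a : M) ∈ U} ∧ d.glue.target = {b : B | (b : M) ∈ U} ∧
      (∀ a : A, (a : M) ∈ U → (d.glue a : M) = T a) ∧
      (∀ b : B, (b : M) ∈ U → (d.glue.symm b : M) = T b) := by
  obtain ⟨f, hf, hfU, hfc, hfs⟩ := exists_glueMap hT hTU A B hUB b₀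
  obtain ⟨f', hf', hf'U, hf'c, hf's⟩ := exists_glueMap hT hTU B A hUA a₀
  let e : OpenPartialHomeomorph A B :=
    { toFun := f
      invFun := f'
      source := {a : A | (a : M) ∈ U}
      target := {b : B | (b : M) ∈ U}
      map_source' := fun a ha => hfU a ha
      map_target' := fun b hb => hf'U b hb
      left_inv' := fun a ha => Subtype.ext (by rw [hf' _ (hfU a ha), hf a ha, hTT _ ha])
      right_inv' := fun b hb => Subtype.ext (by rw [hf _ (hf'U b hb), hf' b hb, hTT _ hb])
      open_source := hU.preimage continuous_subtype_val
      open_target := hU.preimage continuous_subtype_val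
      continuousOn_toFun := hfc
      continuousOn_invFun := hf'c }
  exact ⟨{ glue := e
           contMDiffOn_glue := hfs
           contMDiffOn_glue_symm := hf's
           linA := ContinuousLinearEquiv.refl ℝ E
           linB := ContinuousLinearEquiv.refl ℝ E }, rfl, rfl, hf, hf'⟩

/-- **The differential of the regluing map is that of `T`**: if the gluing map of `d` acts as
`T` on its source `U` (an open set on which `T` is smooth), then `d(glue)_a = dT_a` for `a ∈ U`
(the inclusions of open submanifolds have identity differential). [folklore] -/
theorem mfderiv_glue_eq_of_eq
    {E H : Type*} [NormedAddCommGroup E] [NormedSpace ℝ E] [TopologicalSpace H]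
    {I : ModelWithCorners ℝ E H} {M : Type*} [TopologicalSpace M] [ChartedSpace H M]
    {U : Set M} {T : M → M} (hU : IsOpen U) (hT : ContMDiffOn I I ∞ T U)
    {A B : Opens M} (d : SmoothGlueData I I A B E)
    (hglue : ∀ a : A, (a : M) ∈ U → (d.glue a : M) = T a) {a : A} (ha : (a : M) ∈ U) :
    mfderiv I I d.glue a = mfderiv I I T a := by
  have hev : ∀ᶠ y in 𝓝 a, (d.glue y : M) = (T ∘ Subtype.val) y := by
    filter_upwards [(hU.preimage continuous_subtype_val).mem_nhds ha] with y hy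
    exact hglue y hy
  have hTmd : MDifferentiableAt I I T a :=
    (hT.contMDiffAt (hU.mem_nhds ha)).mdifferentiableAt (by simp)
  have hcomp : HasMFDerivAt I I (T ∘ Subtype.val) a
      ((mfderiv I I T a).comp (ContinuousLinearMap.id ℝ E)) :=
    hTmd.hasMFDerivAt.comp a (OpenSubmanifold.hasMFDerivAt_subtype_val a)
  rw [(hasMFDerivAt_opens_congr hev hcomp).mfderiv]
  ext v
  rfl

/-- **The graph of the regluing map is closed.** Let `K`, `L` be closed sets covering a Hausdorff
space `S`, `U` open, `T` continuous on `U` with `T(U) ⊆ U`, `T ∘ T = id` on `U` and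
`T x ∈ K ↔ x ∈ K` on `U` (side preservation). For spaces `A → S`, `B → S` mapping into
`U ∪ Lᶜ` resp. `U ∪ Kᶜ`, the graph `{(a, b) | a ∈ U, T a = b}` is closed in `A × B`: a limit
point off `U` would have `A`-coordinate off `L` and `B`-coordinate off `K`, while `T` preserves
`K` (Kosinski, *Differential Manifolds* (1993), VI.1, Hausdorffness of pushouts). [folklore] -/
theorem isClosed_regluingGraph {S : Type*} [TopologicalSpace S] [T2Space S]
    {A B : Type*} [TopologicalSpace A] [TopologicalSpace B] {ιA : A → S} {ιB : B → S}
    (hιA : Continuous ιA) (hιB : Continuous ιB) {U K L : Set S} {T : S → S}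
    (hU : IsOpen U) (hK : IsClosed K) (hL : IsClosed L) (hKL : ∀ x, x ∈ K ∨ x ∈ L)
    (hTc : ContinuousOn T U) (hTU : ∀ x ∈ U, T x ∈ U) (hTT : ∀ x ∈ U, T (T x) = x)
    (hside : ∀ x ∈ U, (T x ∈ K ↔ x ∈ K))
    (hA : ∀ a, ιA a ∈ U ∨ ιA a ∉ L) (hB : ∀ b, ιB b ∈ U ∨ ιB b ∉ K) :
    IsClosed {p : A × B | ιA p.1 ∈ U ∧ T (ιA p.1) = ιB p.2} := by
  rw [← isOpen_compl_iff, isOpen_iff_mem_nhds]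
  rintro ⟨a, b⟩ hp
  have hp' : ιA a ∈ U → T (ιA a) ≠ ιB b := fun h1 h2 => hp ⟨h1, h2⟩
  by_cases ha : ιA a ∈ U
  · have hO : IsOpen ((ιA ∘ Prod.fst) ⁻¹' U ∩
        (fun p : A × B => (T (ιA p.1), ιB p.2)) ⁻¹' {q : S × S | q.1 ≠ q.2}) := by
      refine ContinuousOn.isOpen_inter_preimage ?_ (hU.preimage (hιA.comp continuous_fst))
        (isOpen_ne_fun continuous_fst continuous_snd)
      exact (hTc.comp (hιA.comp continuous_fst).continuousOn fun p hp => hp).prodMk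
        (hιB.comp continuous_snd).continuousOn
    refine mem_of_superset (hO.mem_nhds ⟨ha, hp' ha⟩) ?_
    rintro q ⟨-, hq⟩ ⟨-, hq'⟩
    exact hq hq'
  by_cases hb : ιB b ∈ U
  · have hne : T (ιB b) ≠ ιA a := fun h => ha (h ▸ hTU _ hb)
    have hO : IsOpen ((ιB ∘ Prod.snd) ⁻¹' U ∩
        (fun p : A × B => (T (ιB p.2), ιA p.1)) ⁻¹' {q : S × S | q.1 ≠ q.2}) := by
      refine ContinuousOn.isOpen_inter_preimage ?_ (hU.preimage (hιB.comp continuous_snd))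
        (isOpen_ne_fun continuous_fst continuous_snd)
      exact (hTc.comp (hιB.comp continuous_snd).continuousOn fun p hp => hp).prodMk
        (hιA.comp continuous_fst).continuousOn
    refine mem_of_superset (hO.mem_nhds ⟨hb, hne⟩) ?_
    rintro q ⟨hq1, hq2⟩ ⟨hq3, hq4⟩
    apply hq2
    show T (ιB q.2) = ιA q.1
    rw [← hq4, hTT _ hq3]
  · have hO : IsOpen ((ιA ∘ Prod.fst) ⁻¹' Lᶜ ∩ (ιB ∘ Prod.snd) ⁻¹' Kᶜ) :=
      (hL.isOpen_compl.preimage (hιA.comp continuous_fst)).inter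
        (hK.isOpen_compl.preimage (hιB.comp continuous_snd))
    refine mem_of_superset (hO.mem_nhds ⟨(hA a).resolve_left ha, (hB b).resolve_left hb⟩) ?_
    rintro q ⟨hq1, hq2⟩ ⟨hq3, hq4⟩
    have h1 : ιA q.1 ∉ K := fun h => by
      have h' := (hside _ hq3).2 h
      rw [hq4] at h'
      exact hq2 h'
    exact (hKL (ιA q.1)).elim h1 hq1

set_option maxHeartbeats 400000 in
/-- **Isometric regluing along a germ isometry** (stub `stub_isometricRegluing` of the line
`birth` for `WeylBudget.CorkRegluablePsc`). Given the splitting `S⁴ = C ∪_φ W` (piece embeddings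
`jC`, `jW`), a Riemannian metric `g` on `S⁴`, an open `U ⊇ jC(∂C)` and `T` smooth, involutive,
side-preserving and `g`-isometric on `U` with `T ∘ jC ∘ incl = jC ∘ incl ∘ τ` (`τ` an involution
of `∂C`), there is a Hausdorff second-countable smooth 4-manifold `X = C ∪_(φ∘τ) W` (piece
embeddings `kC`, `kW`, seam relation for `τ.trans φ`) with a Riemannian metric `γ` such that
`jC^* g = kC^* γ` and `jW^* g = kW^* γ`. Construction: the open gluing
(`Literature.Topology.FourManifolds.SmoothGlueData`) of the open pieces `A = U ∪ (S⁴ ∖ jW(W))`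
and `B = U ∪ (S⁴ ∖ jC(C))` of the sphere along `T|U`; it is Hausdorff because `T` preserves the
sides (`isClosed_regluingGraph`), compact because `jC(C) ⊆ A`, `jW(W) ⊆ B` cover it, and the
restricted metrics `g|A`, `g|B` descend (`SmoothGlueData.exists_metric_of_glue_isometry`) since
`T^* g = g`; `kC = inl ∘ jC`, `kW = inr ∘ jW` (Hirsch 1976, Ch. 8 §2; Kosinski 1993, VI.1;
O'Neill 1983, Ch. 3, pp. 90–91). [folklore] -/
theorem stub_isometricRegluing :
    ∀ (C : Type) [TopologicalSpace C] [T2Space C] [SecondCountableTopology C]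
    [ChartedSpace (EuclideanHalfSpace 4) C] [IsManifold (𝓡∂ 4) ∞ C] [CompactSpace C]
    (bC : Literature.Topology.FourManifolds.BoundaryData (𝓡∂ 4) C (𝓡 3))
    (W : Type) [TopologicalSpace W] [T2Space W] [SecondCountableTopology W]
    [ChartedSpace (EuclideanHalfSpace 4) W] [IsManifold (𝓡∂ 4) ∞ W] [CompactSpace W]
    (bW : Literature.Topology.FourManifolds.BoundaryData (𝓡∂ 4) W (𝓡 3))
    (φ : bC.carrier ≃ₘ⟮𝓡 3, 𝓡 3⟯ bW.carrier) (τ : bC.carrier ≃ₘ⟮𝓡 3, 𝓡 3⟯ bC.carrier)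
    (jC : C → (Metric.sphere (0 : EuclideanSpace ℝ (Fin 5)) 1))
    (jW : W → (Metric.sphere (0 : EuclideanSpace ℝ (Fin 5)) 1))
    (g : Literature.Geometry.Lorentzian.PseudoRiemannianMetric (𝓡 4) ∞ (EuclideanSpace ℝ (Fin 4)) (TangentSpace (𝓡 4) : (Metric.sphere (0 : EuclideanSpace ℝ (Fin 5)) 1) → Type _))
    (U : Set (Metric.sphere (0 : EuclideanSpace ℝ (Fin 5)) 1))
    (T : (Metric.sphere (0 : EuclideanSpace ℝ (Fin 5)) 1) → (Metric.sphere (0 : EuclideanSpace ℝ (Fin 5)) 1)),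
    Function.Involutive τ →
    Manifold.IsSmoothEmbedding (𝓡∂ 4) (𝓡 4) ∞ jC → Manifold.IsSmoothEmbedding (𝓡∂ 4) (𝓡 4) ∞ jW →
    Set.range jC ∪ Set.range jW = Set.univ →
    (∀ a b, jC a = jW b ↔ ∃ z, a = bC.incl z ∧ b = bW.incl (φ z)) →
    g.IsRiemannian →
    IsOpen U → (∀ z, jC (bC.incl z) ∈ U) → ContMDiffOn (𝓡 4) (𝓡 4) ∞ T U →
    (∀ x ∈ U, T x ∈ U) → (∀ x ∈ U, T (T x) = x) →
    (∀ x ∈ U, (T x ∈ Set.range jC ↔ x ∈ Set.range jC)) →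
    (∀ z, T (jC (bC.incl z)) = jC (bC.incl (τ z))) →
    (∀ x ∈ U, Literature.Geometry.Lorentzian.pullbackBilin (I := 𝓡 4) (I' := 𝓡 4) T g.val x = g.val x) →
    ∃ (X : Type) (_ : TopologicalSpace X) (_ : T2Space X) (_ : SecondCountableTopology X)
    (_ : ChartedSpace (EuclideanSpace ℝ (Fin 4)) X) (_ : IsManifold (𝓡 4) ∞ X)
    (kC : C → X) (kW : W → X)
    (γ : Literature.Geometry.Lorentzian.PseudoRiemannianMetric (𝓡 4) ∞ (EuclideanSpace ℝ (Fin 4)) (TangentSpace (𝓡 4) : X → Type _)),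
    Manifold.IsSmoothEmbedding (𝓡∂ 4) (𝓡 4) ∞ kC ∧ Manifold.IsSmoothEmbedding (𝓡∂ 4) (𝓡 4) ∞ kW ∧
    Set.range kC ∪ Set.range kW = Set.univ ∧
    (∀ a b, kC a = kW b ↔ ∃ z, a = bC.incl z ∧ b = bW.incl ((τ.trans φ) z)) ∧
    γ.IsRiemannian ∧
    (∀ c, Literature.Geometry.Lorentzian.pullbackBilin (I := 𝓡 4) (I' := 𝓡∂ 4) jC g.val c =
    Literature.Geometry.Lorentzian.pullbackBilin (I := 𝓡 4) (I' := 𝓡∂ 4) kC γ.val c) ∧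
    (∀ w, Literature.Geometry.Lorentzian.pullbackBilin (I := 𝓡 4) (I' := 𝓡∂ 4) jW g.val w =
    Literature.Geometry.Lorentzian.pullbackBilin (I := 𝓡 4) (I' := 𝓡∂ 4) kW γ.val w) := by
  intro C _ _ _ _ _ _ bC W _ _ _ _ _ _ bW φ τ jC jW g U T hτ hjC hjW hcov hseam hg hU hYU hT hTU
    hTT hside hTτ hTiso
  -- degenerate case: no boundary, nothing to reglue
  rcases isEmpty_or_nonempty bC.carrier with hemp | ⟨⟨z₀⟩⟩
  · refine ⟨Metric.sphere (0 : EuclideanSpace ℝ (Fin 5)) 1, inferInstance, inferInstance,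
      inferInstance, inferInstance, inferInstance, jC, jW, g, hjC, hjW, hcov, ?_, hg,
      fun c => rfl, fun w => rfl⟩
    intro a b
    rw [hseam a b]
    constructor <;> rintro ⟨z, -, -⟩ <;> exact hemp.elim z
  -- the pieces `jC(C)`, `jW(W)` are closed and cover the sphere
  have hcov' : ∀ x, x ∈ Set.range jC ∨ x ∈ Set.range jW := fun x => Set.eq_univ_iff_forall.1 hcov x
  have hjC_inj : Function.Injective jC := hjC.isEmbedding.injective
  have hKc : IsClosed (Set.range jC) := (isCompact_range hjC.contMDiff.continuous).isClosed
  have hLc : IsClosed (Set.range jW) := (isCompact_range hjW.contMDiff.continuous).isClosed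
  -- the two open pieces of the sphere
  set A : Opens (Metric.sphere (0 : EuclideanSpace ℝ (Fin 5)) 1) :=
    ⟨U ∪ (Set.range jW)ᶜ, hU.union hLc.isOpen_compl⟩
  set B : Opens (Metric.sphere (0 : EuclideanSpace ℝ (Fin 5)) 1) :=
    ⟨U ∪ (Set.range jC)ᶜ, hU.union hKc.isOpen_compl⟩
  have hmemA : ∀ a : A, a.1 ∈ U ∨ a.1 ∉ Set.range jW := fun a => a.2
  have hmemB : ∀ b : B, b.1 ∈ U ∨ b.1 ∉ Set.range jC := fun b => b.2
  -- `jC(C) ⊆ A`, `jW(W) ⊆ B` (a point on both pieces is a seam point, hence in `U`)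
  have hjCA : ∀ c, jC c ∈ A := fun c => (em (jC c ∈ Set.range jW)).imp
    (fun ⟨w, hw⟩ => by obtain ⟨z, rfl, -⟩ := (hseam c w).1 hw.symm; exact hYU z) id
  have hjWB : ∀ w, jW w ∈ B := fun w => (em (jW w ∈ Set.range jC)).imp
    (fun ⟨c, hc⟩ => by obtain ⟨z, rfl, rfl⟩ := (hseam c w).1 hc; exact hc ▸ hYU z) id
  set jC' : C → A := fun c => ⟨jC c, hjCA c⟩
  set jW' : W → B := fun w => ⟨jW w, hjWB w⟩
  have hjC'e : Manifold.IsSmoothEmbedding (𝓡∂ 4) (𝓡 4) ∞ jC' := hjC.opensCodRestrict A hjCA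
  have hjW'e : Manifold.IsSmoothEmbedding (𝓡∂ 4) (𝓡 4) ∞ jW' := hjW.opensCodRestrict B hjWB
  -- the gluing datum `T|U : A ⇀ B`
  obtain ⟨d, hsrc, htgt, hglue, hglue'⟩ := exists_smoothGlueData_of_involutive (I := 𝓡 4) hU hT
    hTU hTT A B Set.subset_union_left Set.subset_union_left (jC' (bC.incl z₀)) ⟨jC (bC.incl z₀),
    Or.inl (hYU z₀)⟩
  -- points of `A` off `jC(C)` are glued to points of `jW(W)`, and symmetrically
  have hcovA : ∀ a : A, a ∉ Set.range jC' → a ∈ d.glue.source ∧ d.glue a ∈ Set.range jW' := by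
    intro a ha
    have h1 : a.1 ∉ Set.range jC := fun ⟨c, hc⟩ => ha ⟨c, Subtype.ext hc⟩
    have h2 : a.1 ∈ U := (hmemA a).resolve_right fun h => h ((hcov' _).resolve_left h1)
    obtain ⟨w, hw⟩ := (hcov' (T a)).resolve_left fun h => h1 ((hside _ h2).1 h)
    exact ⟨by rw [hsrc]; exact h2, w, Subtype.ext (by rw [hglue a h2]; exact hw)⟩
  have hcovB : ∀ b : B, b ∉ Set.range jW' → b ∈ d.glue.target ∧ d.glue.symm b ∈ Set.range jC' := by
    intro b hb
    have h1 : b.1 ∉ Set.range jW := fun ⟨w, hw⟩ => hb ⟨w, Subtype.ext hw⟩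
    have h2 : b.1 ∈ U := (hmemB b).resolve_right fun h => h ((hcov' _).resolve_right h1)
    obtain ⟨c, hc⟩ := (hside _ h2).2 ((hcov' _).resolve_right h1)
    exact ⟨by rw [htgt]; exact h2, c, Subtype.ext (by rw [hglue' b h2]; exact hc)⟩
  -- the glued manifold
  haveI hT2 : T2Space d.Glued := by
    refine d.t2Space_of_isClosed_graph ?_
    have hgraph : {p : A × B | p.1 ∈ d.glue.source ∧ d.glue p.1 = p.2} =
        {p : A × B | p.1.1 ∈ U ∧ T p.1.1 = p.2.1} := by
      ext ⟨a, b⟩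
      simp only [Set.mem_setOf_eq, hsrc]
      exact ⟨fun ⟨ha, hab⟩ => ⟨ha, by rw [← hglue a ha, hab]⟩,
        fun ⟨ha, hab⟩ => ⟨ha, Subtype.ext (by rw [hglue a ha, hab])⟩⟩
    rw [hgraph]
    exact isClosed_regluingGraph continuous_subtype_val continuous_subtype_val hU hKc hLc hcov'
      hT.continuousOn hTU hTT hside hmemA hmemB
  haveI hcpt : CompactSpace d.Glued :=
    d.compactSpace_of_forall_not_mem (isCompact_range hjC'e.contMDiff.continuous)
      (isCompact_range hjW'e.contMDiff.continuous) hcovA hcovB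
  haveI hsc : SecondCountableTopology d.Glued := d.secondCountableTopology
  set gA := g.restrict PseudoRiemannianMetric.contMDiff_restrict_holds A
  set gB := g.restrict PseudoRiemannianMetric.contMDiff_restrict_holds B
  have hiso : ∀ a ∈ d.glue.source, ∀ v w : TangentSpace (𝓡 4) a,
      gB.val (d.glue a) (mfderiv (𝓡 4) (𝓡 4) d.glue a v) (mfderiv (𝓡 4) (𝓡 4) d.glue a w) =
        gA.val a v w := by
    intro a ha v w
    rw [hsrc] at ha
    rw [mfderiv_glue_eq_of_eq hU hT d hglue ha]
    have key := DFunLike.congr_fun (DFunLike.congr_fun (hTiso _ ha) v) w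
    change g.val (d.glue a).1 (mfderiv (𝓡 4) (𝓡 4) T a.1 v) (mfderiv (𝓡 4) (𝓡 4) T a.1 w) =
      g.val a.1 v w
    rw [bilin_congr_point g.val (hglue a ha)]
    exact key
  obtain ⟨γ, hγA, hγB⟩ := d.exists_metric_of_glue_isometry gA gB hiso
  have hγ : γ.IsRiemannian :=
    d.isRiemannian_of_glue gA gB γ hγA hγB (fun a v hv => hg a.1 v hv) (fun b v hv => hg b.1 v hv)
  have hjC'd : ∀ c, HasMFDerivAt (𝓡∂ 4) (𝓡 4) jC' c (mfderiv (𝓡∂ 4) (𝓡 4) jC c) := fun c =>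
    hasMFDerivAt_opens_congr (Eventually.of_forall fun _ => rfl)
      ((hjC.contMDiff c).mdifferentiableAt (by simp)).hasMFDerivAt
  have hjW'd : ∀ w, HasMFDerivAt (𝓡∂ 4) (𝓡 4) jW' w (mfderiv (𝓡∂ 4) (𝓡 4) jW w) := fun w =>
    hasMFDerivAt_opens_congr (Eventually.of_forall fun _ => rfl)
      ((hjW.contMDiff w).mdifferentiableAt (by simp)).hasMFDerivAt
  refine ⟨d.Glued, inferInstance, hT2, hsc, inferInstance, inferInstance, d.inl ∘ jC', d.inr ∘ jW',
    γ, d.isSmoothEmbedding_inl_comp hjC'e, d.isSmoothEmbedding_inr_comp hjW'e, ?_, ?_, hγ, ?_, ?_⟩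
  · -- the two pieces cover the glued manifold
    refine Set.eq_univ_of_forall fun p => ?_
    obtain (⟨a, rfl⟩ | ⟨b, rfl⟩) := d.exists_inl_or_inr p
    · by_cases ha : a ∈ Set.range jC'
      · obtain ⟨c, rfl⟩ := ha
        exact Or.inl ⟨c, rfl⟩
      · obtain ⟨hs, w, hw⟩ := hcovA a ha
        refine Or.inr ⟨w, ?_⟩
        rw [Function.comp_apply, hw, d.inr_glue hs]
    · by_cases hb : b ∈ Set.range jW'
      · obtain ⟨w, rfl⟩ := hb
        exact Or.inr ⟨w, rfl⟩
      · obtain ⟨ht, c, hc⟩ := hcovB b hb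
        refine Or.inl ⟨c, ?_⟩
        rw [Function.comp_apply, hc, d.inl_glue_symm ht]
  · -- the seam relation `incl z ∼ incl (φ (τ z))`
    intro a b
    rw [Function.comp_apply, Function.comp_apply, d.inl_eq_inr_iff, hsrc, Set.mem_setOf_eq]
    constructor
    · rintro ⟨haU, hab⟩
      have hab' : T (jC a) = jW b := by
        simpa only [hglue (jC' a) haU] using congrArg Subtype.val hab
      obtain ⟨a', ha'⟩ := (hside (jC a) haU).2 ⟨a, rfl⟩
      obtain ⟨z, rfl, rfl⟩ := (hseam a' b).1 (ha'.trans hab')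
      refine ⟨τ z, hjC_inj ?_, ?_⟩
      · rw [← hTτ z, ha', hTT (jC a) haU]
      · show bW.incl (φ z) = bW.incl (φ (τ (τ z)))
        rw [hτ z]
    · rintro ⟨z, rfl, rfl⟩
      refine ⟨hYU z, Subtype.ext ?_⟩
      rw [hglue _ (hYU z), hTτ z]
      exact (hseam _ _).2 ⟨τ z, rfl, rfl⟩
  · -- `jC^* g = (inl ∘ jC)^* γ`
    intro c
    have h1 : mfderiv (𝓡∂ 4) (𝓡 4) (d.inl ∘ jC') c =
        (mfderiv (𝓡 4) (𝓡 4) d.inl (jC' c)).comp (mfderiv (𝓡∂ 4) (𝓡 4) jC' c) :=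
      mfderiv_comp c (d.contMDiff_inl.mdifferentiableAt (by simp)) (hjC'd c).mdifferentiableAt
    have h2 : mfderiv (𝓡∂ 4) (𝓡 4) jC' c = mfderiv (𝓡∂ 4) (𝓡 4) jC c := (hjC'd c).mfderiv
    ext v w
    simp only [pullbackBilin_apply, h1, Function.comp_apply]
    refine Eq.symm ((hγA (jC' c) _ _).trans ?_)
    simp only [h2]
    rfl
  · -- `jW^* g = (inr ∘ jW)^* γ`
    intro w'
    have h1 : mfderiv (𝓡∂ 4) (𝓡 4) (d.inr ∘ jW') w' =
        (mfderiv (𝓡 4) (𝓡 4) d.inr (jW' w')).comp (mfderiv (𝓡∂ 4) (𝓡 4) jW' w') :=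
      mfderiv_comp w' (d.contMDiff_inr.mdifferentiableAt (by simp)) (hjW'd w').mdifferentiableAt
    have h2 : mfderiv (𝓡∂ 4) (𝓡 4) jW' w' = mfderiv (𝓡∂ 4) (𝓡 4) jW w' := (hjW'd w').mfderiv
    ext v w
    simp only [pullbackBilin_apply, h1, Function.comp_apply]
    refine Eq.symm ((hγB (jW' w') _ _).trans ?_)
    simp only [h2]
    rfl

end Summit.SmoothPoincare4.SmoothPoincare4.Theorems

end
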